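import Literature.NumberTheory.EllipticCurves.CanonicalPAdicHeightCyc
import Literature.NumberTheory.EllipticCurves.CanonicalPAdicHeightKLocusProofs
import Literature.NumberTheory.EllipticCurves.VariableChangePointsMap
import Literature.NumberTheory.EllipticCurves.TorsionCardinality
import HarnessLib

/-!
# The canonical cyclotomic `2`-adic height over a number field `H`: the admissible locus lies in a
# torsion-free subgroup of `E(H)` (proofs only)

Trunk T-NT-EC (`Literature/NumberTheory/EllipticCurves`). Pure proof file (no definitions, no named
facts); first file of the programme proving the named fact `WeierstrassCurve.exists_isCanonicalCyc`
(`CanonicalPAdicHeightCyc.lean`: existence of THE canonical cyclotomic `p`-adic height datum on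
`E(H)` for a number field `H` with ANY splitting behaviour of `p`) in the case the cell
`bsd-print-cf2` needs: `p = 2` (ramified in `H = K(√d*)`), from a sigma-squared pair of `W ⊗ ℚ₂`.
It is the `H`-side counterpart of §Locus–§Torsion of `CanonicalPAdicHeightSqKExistenceProofs.lean`
(there: `p` totally split in `K`, conditions read at the embeddings `K → ℚ_p` through the formal-group
filtration of `E(ℚ_p)`); here the local conditions of `SatisfiesLocalConditionsCyc` are read at the
primes `w ∣ 2` of `𝓞_H` through Mathlib's `HeightOneSpectrum.valuation`, with no completion and no
`2`-adic analysis.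

THE ONE OBSERVATION. At a prime `w ∣ 2` the two conditions «`P = (x, y)` reduces to `O`»
(`ord_w x < 0`) and «`z = −x/y` lies in the sigma disc» (`ord_w z > ord_w 2`, the `p = 2` case of
`ord_w(z^{p−1}) > ord_w(p)`) say together exactly that the point `(4x, 8y)` of the `2`-RESCALED model
`W⁽²⁾ : y² + 2a₁xy + 8a₃y = x³ + 4a₂x² + 16a₄x + 64a₆` (the admissible change of variables
`u = 1/2`, again with integer coefficients) reduces to `O` at `w`: `ord_w(4x) < 0` (because
`ord_w x = −2 ord_w z` on `E₁`, AEC VII.2.2). Hence the `2`-adic admissible locus at `w`, with `O`,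
is the pull-back of the kernel of reduction `E₁(W⁽²⁾)` at `w` (a subgroup: AEC VII.2.1 for an arbitrary
valuation ring, `ReductionHomomorphism.lean`) along the isomorphism of point groups
`VariableChange.pointEquivBaseChange` — a subgroup, with no new chord-and-tangent estimate.

PROVED:

* `exists_addSubgroup_cycLocus_two` — for `W/ℚ` with integer coefficients (no smoothness needed) and a number field
  `H` there is a subgroup `G ≤ E(H)` which is TORSION-FREE, contains every point satisfying
  `SatisfiesLocalConditionsCyc 2` (so every `2`-adically admissible point), and whose affine members
  `(x, y)` are exactly the points with `1 < w(4x)` (i.e. `ord_w(4x) < 0`) at every prime `w ∋ 2` and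
  non-singular reduction `HasNonsingularReductionAtK` at every finite place; such members satisfy
  `1 < w(x)` and `w(−x/y) < w(2)` at every `w ∋ 2`.
  Torsion-freeness (AEC VII.3.1 / IV.6.1 at a ramified prime above `2`): a multiple `R = (x′, y′)`
  of prime order `q` stays in `G`; for `q` odd, `ΨSq_q(x′) = 0` is impossible since `ΨSq_q` has
  `w`-integral coefficients and unit top coefficient `q²` while `w(x′) > 1`; for `q = 2`,
  `ψ₂²(x′) = 4x′³ + b₂x′² + 2b₄x′ + b₆ = 0` is impossible because `w(4x′) > 1` makes `4x′³` dominate.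
* on the way (private): some prime of `𝓞_H` contains `2`; generic-value-group forms of AEC VII.3.1
  (`val_le_one_of_zsmul_eq_zero_of_model`) and of IV.6.1 at `2` (`two_smul_ne_zero_of_one_lt_val_four_mul`).

This subgroup is the domain on which the companion files prove the parallelogram law of
`canonicalPAdicHeightCyc` (MST 2006 §2.6–2.8) and from which the datum is extended
(`parallelogram_of_generic`, `exists_pairing_of_parallelogram`).

## Sources

* J. H. Silverman, *The Arithmetic of Elliptic Curves*, 2nd ed. (2009): III.1 Table 3.1 (`u`-scaling),
  VII.2.1–2.2 (`E₁`, `E₀`, `3 ord y = 2 ord x` on `E₁`), VII.3.1 and IV.6.1 (torsion in `E₁`),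
  Exercise 3.7 (division polynomials).
* B. Mazur, W. Stein, J. Tate, Doc. Math. Extra Vol. Coates (2006), §2.6–2.7 (admissible points:
  reduce to `0` at `v ∣ p`, identity component everywhere).
* W. Stein, C. Wuthrich, Math. Comp. 82 (2013), §4 (sigma disc `ord_p z > 1/(p−1)`).
-/

noncomputable section

open scoped Classical
open IsDedekindDomain NumberField Polynomial

namespace Literature.NumberTheory.EllipticCurves

/-! ### Generic valuation lemmas (any value group): torsion of `E₁` via division polynomials -/

section Generic

variable {L : Type*} [Field L] {Γ₀ : Type*} [LinearOrderedCommGroupWithZero Γ₀] {w : Valuation L Γ₀}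

/-- Dominant term (any value group): if `q ∈ L[X]` has `w`-integral coefficients, degree `≤ d` and a
unit coefficient in degree `d`, then `w(q(x)) = w(x)^d` for `w x > 1`. [folklore] -/
private theorem val_eval_eq_pow' {q : L[X]} {d : ℕ} (hq : ∀ i, w (q.coeff i) ≤ 1)
    (hd : q.natDegree ≤ d) (hlead : w (q.coeff d) = 1) {x : L} (hx : 1 < w x) :
    w (q.eval x) = w x ^ d := by
  have htop : w (q.coeff d * x ^ d) = w x ^ d := by rw [map_mul, map_pow, hlead, one_mul]
  rw [eval_eq_sum_range' (Nat.lt_succ_of_le hd), Finset.sum_range_succ,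
    Valuation.map_add_eq_of_lt_right]
  · exact htop
  · rw [htop]
    refine Valuation.map_sum_lt _ (pow_ne_zero _ (zero_lt_one.trans hx).ne') fun i hi ↦ ?_
    rw [Finset.mem_range] at hi
    rw [map_mul, map_pow]
    calc w (q.coeff i) * w x ^ i ≤ 1 * w x ^ i := by gcongr; exact hq i
      _ = w x ^ i := one_mul _
      _ < w x ^ d := pow_lt_pow_right₀ hx hi

/-- **Torsion of order prime to the residue characteristic is integral** (AEC VII.3.1, any value
group): on the base change `M_L` of an equation `M` over the valuation ring of `w`, if `w n = 1` and
`n • (x, y) = O` then `w x ≤ 1` (`ΨSqₙ(x) = 0`, `ΨSqₙ` integral of degree `n² − 1` with top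
coefficient `n²`). [cite: SilvermanAEC2009, VII.3.1 and Exercise 3.7 (method)] -/
theorem val_le_one_of_zsmul_eq_zero_of_model (M : WeierstrassCurve w.valuationSubring) {n : ℤ}
    (hn : w n = 1) {x y : L} {hP : (M.baseChange L).toAffine.Nonsingular x y}
    (h0 : n • (WeierstrassCurve.Affine.Point.some x y hP) = 0) : w x ≤ 1 := by
  by_contra hx
  rw [not_le] at hx
  have hΨ : ((M.baseChange L).ΨSq n).eval x = 0 :=
    ((M.baseChange L).zsmul_some_eq_zero_iff_eval_ΨSq hP n).mp h0
  have hmap : (M.baseChange L).ΨSq n = (M.ΨSq n).map (algebraMap w.valuationSubring L) := by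
    rw [← WeierstrassCurve.map_ΨSq, WeierstrassCurve.baseChange]
  have hval : w (((M.baseChange L).ΨSq n).eval x) = w x ^ (n.natAbs ^ 2 - 1) := by
    refine val_eval_eq_pow' (fun i ↦ ?_) ((M.baseChange L).natDegree_ΨSq_le n) ?_ hx
    · rw [hmap, coeff_map]
      exact (Valuation.mem_valuationSubring_iff _ _).mp ((M.ΨSq n).coeff i).2
    · rw [(M.baseChange L).coeff_ΨSq n, map_pow, hn, one_pow]
  rw [hΨ, map_zero] at hval
  exact pow_ne_zero _ (zero_lt_one.trans hx).ne' hval.symm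

/-- **No `2`-torsion deep in `E₁` at a prime above `2`** (AEC IV.6.1 at `p = 2`, any ramification):
on `M_L` (`M` over the valuation ring of `w`), a point `(x, y)` with `w(4x) > 1` is not killed by `2`:
`ψ₂²(x) = 4x³ + b₂x² + 2b₄x + b₆` has the STRICTLY dominant term `4x³` (`w(4x) > 1` gives
`w(4)w(x)³ > w(x)² ≥ w(b₂x²)`, `> w(2)w(x) ≥ w(2b₄x)`, `> 1 ≥ w(b₆)`), so it is nonzero.
[cite: SilvermanAEC2009, IV.6.1 and Exercise 3.7 (method)] -/
theorem two_smul_ne_zero_of_one_lt_val_four_mul (M : WeierstrassCurve w.valuationSubring)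
    (h2 : w (2 : L) ≤ 1) {x y : L} (hP : (M.baseChange L).toAffine.Nonsingular x y)
    (hx : 1 < w (4 * x)) :
    (2 : ℤ) • (WeierstrassCurve.Affine.Point.some x y hP) ≠ 0 := by
  intro h0
  have hΨ : ((M.baseChange L).ΨSq 2).eval x = 0 :=
    ((M.baseChange L).zsmul_some_eq_zero_iff_eval_ΨSq hP 2).mp h0
  rw [WeierstrassCurve.ΨSq_two] at hΨ
  -- the `b`'s of `M_L` are the (integral) `b`'s of `M`
  have eb₂ : (M.baseChange L).b₂ = (M.b₂ : L) := by
    rw [WeierstrassCurve.baseChange, WeierstrassCurve.map_b₂]; rfl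
  have eb₄ : (M.baseChange L).b₄ = (M.b₄ : L) := by
    rw [WeierstrassCurve.baseChange, WeierstrassCurve.map_b₄]; rfl
  have eb₆ : (M.baseChange L).b₆ = (M.b₆ : L) := by
    rw [WeierstrassCurve.baseChange, WeierstrassCurve.map_b₆]; rfl
  have hev : (M.baseChange L).Ψ₂Sq.eval x =
      4 * x ^ 3 + ((M.b₂ : L) * x ^ 2 + 2 * (M.b₄ : L) * x + (M.b₆ : L)) := by
    rw [WeierstrassCurve.Ψ₂Sq, eb₂, eb₄, eb₆]
    simp only [eval_add, eval_mul, eval_C, eval_pow, eval_X]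
    ring
  have hb₂ : w (M.b₂ : L) ≤ 1 := (Valuation.mem_valuationSubring_iff _ _).mp M.b₂.2
  have hb₄ : w (M.b₄ : L) ≤ 1 := (Valuation.mem_valuationSubring_iff _ _).mp M.b₄.2
  have hb₆ : w (M.b₆ : L) ≤ 1 := (Valuation.mem_valuationSubring_iff _ _).mp M.b₆.2
  -- sizes: `a = w x`, `t = w 2`, `w 4 = t²`, `1 < t² a`, hence `1 < t a`, `1 < a`
  set a := w x with ha
  set t := w (2 : L) with ht
  have h4 : w (4 : L) = t * t := by rw [show (4 : L) = 2 * 2 by norm_num, map_mul]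
  have hx4 : 1 < t * t * a := by rwa [map_mul, h4] at hx
  have htt : t * t ≤ t := mul_le_of_le_one_left' h2
  have hx2 : 1 < t * a := lt_of_lt_of_le hx4 (mul_le_mul_left htt a)
  have hx1 : 1 < a := lt_of_lt_of_le hx2 (mul_le_of_le_one_left' h2)
  have ha0 : a ≠ 0 := (zero_lt_one.trans hx1).ne'
  have hta0 : t * a ≠ 0 := (zero_lt_one.trans hx2).ne'
  have htta0 : t * t * a ≠ 0 := (zero_lt_one.trans hx4).ne'
  have hlead : w (4 * x ^ 3) = t * t * a * (a * a) := by
    rw [map_mul, map_pow, h4, ← ha, pow_three]; ac_rfl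
  -- each lower term is strictly smaller than `w(4x³)`
  have hapos : 0 < a * a := mul_pos (zero_lt_one.trans hx1) (zero_lt_one.trans hx1)
  have ht2 : w ((M.b₂ : L) * x ^ 2) < w (4 * x ^ 3) := by
    rw [hlead, map_mul, map_pow, sq]
    calc w (M.b₂ : L) * (a * a) ≤ 1 * (a * a) := mul_le_mul_left hb₂ _
      _ < t * t * a * (a * a) := mul_lt_mul_of_pos_right hx4 hapos
  have ht1 : w (2 * (M.b₄ : L) * x) < w (4 * x ^ 3) := by
    rw [hlead, map_mul, map_mul]
    calc t * w (M.b₄ : L) * a ≤ t * 1 * a := mul_le_mul_left (mul_le_mul_right hb₄ _) _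
      _ = 1 * (t * a) := by rw [mul_one, one_mul]
      _ < t * a * (t * a) := mul_lt_mul_of_pos_right hx2 (zero_lt_one.trans hx2)
      _ = t * t * a * a := by ac_rfl
      _ ≤ t * t * a * (a * a) := mul_le_mul_right (le_mul_of_one_le_left' hx1.le) _
  have ht0 : w (M.b₆ : L) < w (4 * x ^ 3) := by
    rw [hlead]
    calc w (M.b₆ : L) ≤ 1 := hb₆
      _ < t * t * a := hx4
      _ ≤ t * t * a * (a * a) := le_mul_of_one_le_right' (one_le_mul hx1.le hx1.le)
  have hsum : w ((M.b₂ : L) * x ^ 2 + 2 * (M.b₄ : L) * x + (M.b₆ : L)) < w (4 * x ^ 3) :=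
    Valuation.map_add_lt w (Valuation.map_add_lt w ht2 ht1) ht0
  have hne : w (4 * x ^ 3 + ((M.b₂ : L) * x ^ 2 + 2 * (M.b₄ : L) * x + (M.b₆ : L))) =
      w (4 * x ^ 3) :=
    Valuation.map_add_eq_of_lt_left w hsum
  rw [← hev, hΨ, map_zero, hlead] at hne
  exact mul_ne_zero htta0 (mul_ne_zero ha0 ha0) hne.symm

end Generic

/-! ### The `2`-rescaled model and the subgroup -/

section NumberField

variable (W : WeierstrassCurve ℚ) [hW : W.IsIntegral ℤ] (H : Type) [Field H] [NumberField H]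

/-- Some prime of `𝓞_H` contains `2` (`2` is not a unit: its norm down to `ℤ` is `2^{[H:ℚ]}`).
[folklore] -/
private theorem exists_heightOneSpectrum_two_mem :
    ∃ w : HeightOneSpectrum (𝓞 H), ((2 : ℕ) : 𝓞 H) ∈ w.asIdeal := by
  have hnu : ¬ IsUnit ((2 : ℕ) : 𝓞 H) := by
    intro hu
    have h := hu.map (Algebra.norm ℤ)
    rw [show ((2 : ℕ) : 𝓞 H) = algebraMap ℤ (𝓞 H) 2 by rw [map_ofNat, Nat.cast_ofNat],
      Algebra.norm_algebraMap,
      Int.isUnit_iff, RingOfIntegers.rank] at h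
    have hk : 0 < Module.finrank ℚ H := Module.finrank_pos
    have h1 : (1 : ℤ) < 2 ^ Module.finrank ℚ H := one_lt_pow₀ (by norm_num) hk.ne'
    omega
  obtain ⟨M, hM, hle⟩ := Ideal.exists_le_maximal (Ideal.span {((2 : ℕ) : 𝓞 H)})
    fun h => hnu (Ideal.span_singleton_eq_top.mp h)
  have hMne : M ≠ ⊥ := fun h => by
    rw [h, Ideal.span_singleton_le_iff_mem, Ideal.mem_bot] at hle
    exact two_ne_zero (by exact_mod_cast hle : ((2 : ℕ) : 𝓞 H) = 0)
  exact ⟨⟨M, hM.isPrime, hMne⟩, hle (Ideal.mem_span_singleton_self _)⟩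

omit hW in
/-- The valuation of `2` at any finite place is `≤ 1`. [folklore] -/
private theorem valuation_two_le_one (w : HeightOneSpectrum (𝓞 H)) : w.valuation H (2 : H) ≤ 1 := by
  rw [show (2 : H) = algebraMap (𝓞 H) H ((2 : ℕ) : 𝓞 H) by rw [map_natCast, Nat.cast_ofNat]]
  exact w.valuation_le_one _

omit hW in
/-- At a prime `w ∋ 2`, an odd integer prime `q` is a `w`-adic unit. [folklore] -/
private theorem valuation_odd_prime_eq_one {w : HeightOneSpectrum (𝓞 H)}
    (hw : ((2 : ℕ) : 𝓞 H) ∈ w.asIdeal) {q : ℕ} (hq : q.Prime) (hq2 : q ≠ 2) :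
    w.valuation H ((q : ℤ) : H) = 1 := by
  rw [show ((q : ℤ) : H) = algebraMap (𝓞 H) H ((q : ℕ) : 𝓞 H) by
    rw [map_natCast, Int.cast_natCast]]
  refine (HeightOneSpectrum.valuation_eq_one_iff_notMem (K := H) w).mpr fun hq' => ?_
  have hodd : Odd q := hq.odd_of_ne_two hq2
  obtain ⟨k, hk⟩ := hodd
  have h1 : (1 : 𝓞 H) = ((q : ℕ) : 𝓞 H) - (k : 𝓞 H) * ((2 : ℕ) : 𝓞 H) := by
    rw [hk]; push_cast; ring
  have : (1 : 𝓞 H) ∈ w.asIdeal := by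
    rw [h1]; exact w.asIdeal.sub_mem hq' (w.asIdeal.mul_mem_left _ hw)
  exact w.asIdeal.ne_top_iff_one.mp w.isPrime.ne_top this

/-- **The torsion-free subgroup containing the `2`-adic admissible locus of `E(H)`.** For `W/ℚ`
with integer coefficients and a number field `H` there is a subgroup `G` of `E(H)` with:
(i) `G` is torsion-free; (ii) an affine point `(x, y)` lies in `G` iff `1 < w(4x)` (`ord_w(4x) < 0`)
at every prime `w ∋ 2` of `𝓞_H` and `(x, y)` has non-singular reduction at every finite place;
(iii) every point satisfying the local conditions `SatisfiesLocalConditionsCyc 2` lies in `G`;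
(iv) affine members satisfy `1 < w(x)` and `w(−x/y) < w(2)` at every `w ∋ 2`.
(`G = ⨅_{w∋2} E₁(W⁽²⁾) at w ⊓ ⨅_v E₀ at v`, `W⁽²⁾` the `u = 1/2` rescaling; see the module docstring.)
[cite: SilvermanAEC2009, VII.2.1–2.2 and VII.3.1] [cite: MazurSteinTate2006, §2.6–2.7]
[cite: SteinWuthrich2013, §4] -/
theorem exists_addSubgroup_cycLocus_two :
    ∃ G : AddSubgroup (W.baseChange H).toAffine.Point,
      (∀ P ∈ G, IsOfFinAddOrder P → P = 0) ∧
      (∀ {x y : H} (h : (W.baseChange H).toAffine.Nonsingular x y),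
        (.some x y h : (W.baseChange H).toAffine.Point) ∈ G ↔
          (∀ w : HeightOneSpectrum (𝓞 H), ((2 : ℕ) : 𝓞 H) ∈ w.asIdeal →
              1 < w.valuation H (4 * x)) ∧
            ∀ v : HeightOneSpectrum (𝓞 H), W.HasNonsingularReductionAtK H v x y) ∧
      (∀ P, W.SatisfiesLocalConditionsCyc 2 H P → P ∈ G) ∧
      (∀ {x y : H} (h : (W.baseChange H).toAffine.Nonsingular x y),
        (.some x y h : (W.baseChange H).toAffine.Point) ∈ G →
          ∀ w : HeightOneSpectrum (𝓞 H), ((2 : ℕ) : 𝓞 H) ∈ w.asIdeal →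
            1 < w.valuation H x ∧ w.valuation H (-x / y) < w.valuation H (2 : H)) := by
  -- the `2`-rescaling `u = 1/2`
  set C₂ : WeierstrassCurve.VariableChange ℚ :=
    ⟨⟨(2 : ℚ)⁻¹, 2, by norm_num, by norm_num⟩, 0, 0, 0⟩ with hC₂
  haveI hint : (C₂ • W).IsIntegral ℤ := by
    obtain ⟨M, hM⟩ := hW.integral
    refine WeierstrassCurve.isIntegral_of_exists_lift ℤ ⟨2 * M.a₁, ?_⟩ ⟨4 * M.a₂, ?_⟩ ⟨8 * M.a₃, ?_⟩
      ⟨16 * M.a₄, ?_⟩ ⟨64 * M.a₆, ?_⟩ <;>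
    simp only [hM, hC₂, WeierstrassCurve.variableChange_a₁, WeierstrassCurve.variableChange_a₂,
      WeierstrassCurve.variableChange_a₃, WeierstrassCurve.variableChange_a₄,
      WeierstrassCurve.variableChange_a₆, WeierstrassCurve.baseChange, WeierstrassCurve.map_a₁,
      WeierstrassCurve.map_a₂, WeierstrassCurve.map_a₃, WeierstrassCurve.map_a₄,
      WeierstrassCurve.map_a₆, inv_inv, Units.val_inv_eq_inv_val, map_mul, eq_intCast,
      algebraMap_int_eq] <;> push_cast <;> ring
  -- the new `x`-coordinate is `4x`
  have htoX : ∀ x : H, (C₂.map (algebraMap ℚ H)).toX x = 4 * x := fun x => by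
    rw [WeierstrassCurve.VariableChange.toX_def]
    simp only [hC₂, WeierstrassCurve.VariableChange.map, Units.val_inv_eq_inv_val,
      Units.coe_map, MonoidHom.coe_coe, map_inv₀, map_ofNat, inv_inv, map_zero, sub_zero]
    norm_num
  -- the subgroup
  let f : (W.baseChange H).toAffine.Point →+ ((C₂ • W).baseChange H).toAffine.Point :=
    (WeierstrassCurve.VariableChange.pointEquivBaseChange W C₂ H).toAddMonoidHom
  let D : HeightOneSpectrum (𝓞 H) → AddSubgroup (W.baseChange H).toAffine.Point := fun w =>
    (WeierstrassCurve.kernelOfReduction (K := H) (placeIntModel (C₂ • W) H w)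
      (valuation_integers_valuationSubring _)).comap f
  let G : AddSubgroup (W.baseChange H).toAffine.Point :=
    (⨅ w : {w : HeightOneSpectrum (𝓞 H) // ((2 : ℕ) : 𝓞 H) ∈ w.asIdeal}, D w.1) ⊓
      ⨅ v : HeightOneSpectrum (𝓞 H), nonsingularReductionSubgroupAtPlace W H v
  -- membership in `D w` in coordinates
  have hD : ∀ (w : HeightOneSpectrum (𝓞 H)) {x y : H} (h : (W.baseChange H).toAffine.Nonsingular x y),
      (.some x y h : (W.baseChange H).toAffine.Point) ∈ D w ↔ 1 < w.valuation H (4 * x) := by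
    intro w x y h
    rw [AddSubgroup.mem_comap]
    change WeierstrassCurve.ReducesToZero (K := H) (placeIntModel (C₂ • W) H w)
      (WeierstrassCurve.VariableChange.pointEquivBaseChange W C₂ H (.some x y h)) ↔ _
    rw [WeierstrassCurve.VariableChange.pointEquivBaseChange_some]
    refine (WeierstrassCurve.reducesToZero_some_iff (W := placeIntModel (C₂ • W) H w) _).trans ?_
    rw [not_mem_range_iff (valuation_integers_valuationSubring _), htoX]
  -- membership in `G` in coordinates
  have hG : ∀ {x y : H} (h : (W.baseChange H).toAffine.Nonsingular x y),
      (.some x y h : (W.baseChange H).toAffine.Point) ∈ G ↔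
        (∀ w : HeightOneSpectrum (𝓞 H), ((2 : ℕ) : 𝓞 H) ∈ w.asIdeal → 1 < w.valuation H (4 * x)) ∧
          ∀ v : HeightOneSpectrum (𝓞 H), W.HasNonsingularReductionAtK H v x y := by
    intro x y h
    rw [AddSubgroup.mem_inf, AddSubgroup.mem_iInf, AddSubgroup.mem_iInf]
    refine and_congr ⟨fun hx w hw => (hD w h).mp (hx ⟨w, hw⟩), fun hx w => (hD w.1 h).mpr (hx w.1 w.2)⟩
      (forall_congr' fun v => some_mem_nonsingularReductionSubgroupAtPlace_iff v h)
  -- (iv): members have `1 < w x` and `w z < w 2`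
  have hfacts : ∀ {x y : H} (h : (W.baseChange H).toAffine.Nonsingular x y)
      (w : HeightOneSpectrum (𝓞 H)), 1 < w.valuation H (4 * x) →
        1 < w.valuation H x ∧ w.valuation H (-x / y) < w.valuation H (2 : H) := by
    intro x y h w hx4
    have hv := valuation_integers_valuationSubring (w.valuation H)
    have h2 := valuation_two_le_one H w
    have h4le : w.valuation H (4 * x) ≤ w.valuation H x := by
      rw [map_mul, show (4 : H) = 2 * 2 by norm_num, map_mul]
      exact mul_le_of_le_one_left' (mul_le_one' h2 h2)
    have hx1 : 1 < w.valuation H x := lt_of_lt_of_le hx4 h4le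
    have heq : ((placeIntModel W H w).baseChange H).toAffine.Equation x y := h.1
    obtain ⟨-, -, -, -, hzx⟩ := v_zw_of_one_lt hv heq hx1
    refine ⟨hx1, ?_⟩
    -- `w z ^ 2 * w x = 1` and `w 4 * w x > 1` give `w z ^ 2 < w 4 = (w 2)^2`
    by_contra hle
    rw [not_lt] at hle
    have hsq : w.valuation H (2 : H) ^ 2 ≤ w.valuation H (-x / y) ^ 2 :=
      pow_le_pow_left₀ zero_le hle 2
    have hx0 : 0 < w.valuation H x := zero_lt_one.trans hx1
    have : w.valuation H (4 * x) ≤ 1 := by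
      rw [map_mul, show (4 : H) = 2 ^ 2 by norm_num, map_pow, ← hzx]
      exact mul_le_mul_left hsq _
    exact (not_lt.mpr this) hx4
  refine ⟨G, ?_, hG, ?_, fun h hP w hw => hfacts h w (((hG h).mp hP).1 w hw)⟩
  · -- (i) torsion-free
    intro P hP hfin
    by_contra hP0
    obtain ⟨w₀, hw₀⟩ := exists_heightOneSpectrum_two_mem H
    have hN : 0 < addOrderOf P := hfin.addOrderOf_pos
    have hN1 : addOrderOf P ≠ 1 := by rwa [Ne, AddMonoid.addOrderOf_eq_one_iff]
    obtain ⟨q, hq, hqN⟩ := Nat.exists_prime_and_dvd hN1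
    obtain ⟨m, hm⟩ := hqN
    have hm0 : m ≠ 0 := by rintro rfl; rw [mul_zero] at hm; omega
    have hmlt : m < addOrderOf P := by
      rw [hm]; exact lt_mul_left (Nat.pos_of_ne_zero hm0) hq.one_lt
    have hRmem : m • P ∈ G := G.nsmul_mem hP m
    have hR0 : m • P ≠ 0 := nsmul_ne_zero_of_lt_addOrderOf hm0 hmlt
    have hqR : q • (m • P) = 0 := by
      rw [← mul_nsmul, Nat.mul_comm m q, ← hm]; exact addOrderOf_nsmul_eq_zero P
    rcases hR : m • P with _ | ⟨x', y', h'⟩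
    · exact hR0 hR
    rw [hR] at hRmem hqR
    have hx4 : 1 < w₀.valuation H (4 * x') := ((hG h').mp hRmem).1 w₀ hw₀
    have hqR' : (q : ℤ) • (.some x' y' h' : (W.baseChange H).toAffine.Point) = 0 := by
      rw [natCast_zsmul]; exact hqR
    -- read the point on the integral model at `w₀`
    have h'' : ((placeIntModel W H w₀).baseChange H).toAffine.Nonsingular x' y' := h'
    have hqR'' : (q : ℤ) • (WeierstrassCurve.Affine.Point.some x' y' h'' :
        ((placeIntModel W H w₀).baseChange H).toAffine.Point) = 0 := hqR'
    by_cases hq2 : q = 2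
    · subst hq2
      exact two_smul_ne_zero_of_one_lt_val_four_mul (placeIntModel W H w₀)
        (valuation_two_le_one H w₀) h'' hx4 hqR''
    · have hq1 : w₀.valuation H ((q : ℤ) : H) = 1 := valuation_odd_prime_eq_one H hw₀ hq hq2
      have hle := val_le_one_of_zsmul_eq_zero_of_model (placeIntModel W H w₀) hq1 hqR''
      exact (not_lt.mpr hle) (hfacts h' w₀ hx4).1
  · -- (iii) the Cyc-admissible locus at `p = 2` lies in `G`
    intro P hP
    rcases P with _ | ⟨x, y, h⟩
    · exact hP.elim
    obtain ⟨hloc, hns⟩ := hP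
    refine (hG h).mpr ⟨fun w hw => ?_, hns⟩
    obtain ⟨hx1, hz⟩ := hloc w hw
    rw [show (2 : ℕ) - 1 = 1 from rfl, pow_one, Nat.cast_ofNat] at hz
    have hv := valuation_integers_valuationSubring (w.valuation H)
    have heq : ((placeIntModel W H w).baseChange H).toAffine.Equation x y := h.1
    obtain ⟨-, -, -, -, hzx⟩ := v_zw_of_one_lt hv heq hx1
    -- `w(4x) = w(2)² · w(x) = w(2)² / w(z)² > 1`
    have hsq : w.valuation H (-x / y) ^ 2 < w.valuation H (2 : H) ^ 2 :=
      pow_lt_pow_left₀ hz zero_le two_ne_zero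
    have hx0 : 0 < w.valuation H x := zero_lt_one.trans hx1
    rw [map_mul, show (4 : H) = 2 ^ 2 by norm_num, map_pow, ← hzx]
    exact mul_lt_mul_of_pos_right hsq hx0

end NumberField

end Literature.NumberTheory.EllipticCurves

end
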